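import Mathlib
import Literature.Analysis.FunctionSpaces.ContDiffHolderCompactInclusion
import Summits.SmoothPoincare4.SmoothPoincare4.Theorems.SullivanDualTameOrBrodyR4CoreAChartVorticity
import Summits.SmoothPoincare4.SmoothPoincare4.Theorems.SullivanDualTameOrBrodyR4CoreAFredholm
import Summits.SmoothPoincare4.SmoothPoincare4.Theorems.SullivanDualTameOrBrodyR4CoreAKernel
import Literature.Analysis.Calculus.SmoothImplicitFunction

/-!
# CORE-A of crux `TameOrBrodyR4` (stmt-SmoothPoincare4-7826), line `Sketch`: linear theory and the
# implicit function of the vorticity map of a chart (lead c6, layer A7b)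

For the vorticity data of a chart (`…CoreAChartVorticity.lean`) at any Hölder order `k`:

* `ChartData.isCompactOperator_L_sub_one` — `L - 1` is compact (`isCompactOperator_inclCLM_comp`);
* `ChartData.L_injective` — `L` is injective (`CoreA.kernel_trivial` + `helper_decayingKernelZero`);
* `ChartData.exists_implicitFunction` — Fredholm (`helper_fredholmOneAdd`) and the smooth implicit
  function theorem (`Literature.Analysis.Calculus.exists_smooth_implicitFunction`) give `ε, δ > 0`
  and a `C^∞` map `γ : ball 0 ε → C^{k,r}_b` of zeros of the vorticity map, unique in
  `ball 0 ε × ball 0 δ` (registered as `helper_chartImplicitFunction`).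
-/

-- the registered namespace `Summit.SmoothPoincare4.SmoothPoincare4.…` repeats a component
set_option linter.dupNamespace false
set_option maxSynthPendingDepth 3

noncomputable section

open scoped ContDiff Topology NNReal
open Filter Set Function Metric Literature.Analysis.Complex Literature.Analysis.FunctionSpaces
  Literature.Analysis.Calculus Literature.Geometry.Symplectic

namespace Summit.SmoothPoincare4.SmoothPoincare4.Cruxes.TameOrBrodyR4.Sketch

namespace CoreA

/-- Local notation for the model space `ℝ⁴ = EuclideanSpace ℝ (Fin 4)`. -/
local notation "E4" => EuclideanSpace ℝ (Fin 4)
/-- Local notation for the complex model plane `ℂ²`. -/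
local notation "F2" => ℂ × ℂ
namespace ChartData

variable {J : E4 → E4 →L[ℝ] E4} {R : ℝ} {P Q : E4 →L[ℝ] ℂ} {eP eQ : ℂ →L[ℝ] E4} {b₀ : ℂ}
  {u₀ : ℂ → E4} (𝒞 : ChartData J R P Q eP eQ b₀ u₀)
  {r : ℝ≥0} (hr0 : 0 < r) (hr1 : r < 1) (hJs : ContDiff ℝ ∞ J) (hu₀s : ContDiff ℝ ∞ u₀) {k : ℕ}

/-! ### The linear theory: `L - 1` is compact and `L` is injective -/

/-- The lift of `L - 1` through `C^{k+1,r}_b`: `h ↦ χ • (S₁fun · 𝒯 h)` at order `k + 1`. -/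
def Klift : ContDiffHolderFunction ℂ F2 k r →L[ℝ] ContDiffHolderFunction ℂ F2 (k + 1) r :=
  (ContDiffHolderFunction.coeffCLM hr1.le 𝒞.χ 𝒞.hχ 𝒞.hχs).comp
    ((app hr1.le (mkc hr1.le 𝒞.S₁fun (𝒞.contDiff_S₁fun hJs hu₀s) 𝒞.hasCompactSupport_S₁fun)).comp
      (𝒞.vorticity hr0 hr1 hJs hu₀s k).𝒯)

/-- `L - 1 = incl ∘ Klift`. -/
theorem L_sub_one_eq :
    ((𝒞.vorticity hr0 hr1 hJs hu₀s k).L hr1.le - 1 :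
        ContDiffHolderFunction ℂ F2 k r →L[ℝ] ContDiffHolderFunction ℂ F2 k r) =
      (ContDiffHolderFunction.inclCLM hr1.le).comp (𝒞.Klift hr0 hr1 hJs hu₀s) := by
  refine ContinuousLinearMap.ext fun h => ContDiffHolderFunction.ext fun x => ?_
  rw [sub_apply]
  change ((𝒞.vorticity hr0 hr1 hJs hu₀s k).L hr1.le h) x - h x = _
  rw [VorticityData.L_apply]
  change h x + _ - h x = _
  rw [add_sub_cancel_left]
  simp only [Klift, ContinuousLinearMap.comp_apply, ContDiffHolderFunction.inclCLM_apply,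
    ContDiffHolderFunction.coeffCLM_apply, app_apply, mkc_apply, S₁_apply]
  rfl

/-- **`L - 1` is a compact operator.** -/
theorem isCompactOperator_L_sub_one :
    IsCompactOperator ((𝒞.vorticity hr0 hr1 hJs hu₀s k).L hr1.le - 1 :
        ContDiffHolderFunction ℂ F2 k r →L[ℝ] ContDiffHolderFunction ℂ F2 k r) := by
  rw [L_sub_one_eq]
  refine ContDiffHolderFunction.isCompactOperator_inclCLM_comp hr0 hr1.le _ 𝒞.hχs.isCompact ?_
  intro h
  refine closure_mono fun x hx => ?_
  rw [Function.mem_support] at hx ⊢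
  intro hχx
  apply hx
  simp [Klift, ContDiffHolderFunction.coeffCLM_apply, hχx]

omit hr0 hJs hu₀s 𝒞 in
include hr1 in
/-- Order reduction to `0`: `C^{k,r}_b ⊆ C^{0,r}_b`. -/
theorem memContDiffHolder_zero_of {k : ℕ} {f : ℂ → F2} (hf : MemContDiffHolder k r f) :
    MemContDiffHolder 0 r f := by
  induction k with
  | zero => exact hf
  | succ k ih => exact ih (hf.of_succ hr1.le)

/-- A member of `C^{k,r}_b` read at order `0`. -/
def toOrderZero (h : ContDiffHolderFunction ℂ F2 k r) : ContDiffHolderFunction ℂ F2 0 r :=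
  ⟨h, memContDiffHolder_zero_of hr1 h.memContDiffHolder⟩

/-- Pointwise formula for `toOrderZero`. -/
@[simp] theorem toOrderZero_apply (h : ContDiffHolderFunction ℂ F2 k r) (x : ℂ) :
    toOrderZero hr1 h x = h x := rfl

/-- **`L` is injective** (the kernel theorem `CoreA.kernel_trivial`). -/
theorem L_injective (hR : 0 < R) (hJ2 : ∀ x v, J x (J x v) = -v) (hPQ : IsCoordFrame P Q eP eQ)
    (hJP : ∀ x : E4, R ≤ ‖x‖ → ∀ v, P (J x v) = Complex.I * P v)
    (hJQ : ∀ x : E4, R ≤ ‖x‖ → ∀ v, Q (J x v) = Complex.I * Q v)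
    (hu₀J : IsJHolomorphicFlat J u₀) (h : ContDiffHolderFunction ℂ F2 k r)
    (hh : (𝒞.vorticity hr0 hr1 hJs hu₀s k).L hr1.le h = 0) : h = 0 := by
  obtain ⟨hSs, htri, hS0⟩ := 𝒞.S_props hR hJs hJ2 hPQ hJP hJQ hu₀s hu₀J
  obtain ⟨M, hM⟩ := 𝒞.S_bound hSs hS0
  have hSχ : ∀ x, 𝒞.χ x ≠ 1 → 𝒞.S x = 0 := by
    intro x hx
    apply hS0
    by_contra hlt
    exact hx (𝒞.hχ_one x (le_of_lt (not_le.mp hlt)))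
  -- the kernel identity pointwise, read at order `0`
  have hker : ∀ x, toOrderZero hr1 h x + 𝒞.χ x • 𝒞.S₁fun x
      (cauchyTransformAlong (1 : ℂ) (fun w => 𝒞.χ₁ w • toOrderZero hr1 h w) x) = 0 := by
    intro x
    have hx : ((𝒞.vorticity hr0 hr1 hJs hu₀s k).L hr1.le h) x = 0 := by rw [hh]; rfl
    rw [VorticityData.L_apply] at hx
    simpa only [ContDiffHolderFunction.coe_add, Pi.add_apply, ContDiffHolderFunction.coeffCLM_apply,
      vorticity_χ, app_apply, S₁_apply, ContDiffHolderFunction.inclCLM_apply, vorticity_𝒯_apply,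
      toOrderZero_apply] using hx
  have h0 := kernel_trivial hr0 hr1 (cauchyTransformHolderApriori_of_lt_one F2 hr0 hr1) 𝒞.S
    (𝒞.ρ₁ + 1) M hSs hS0 hM htri 𝒞.χ 𝒞.χ₁ 𝒞.hχ 𝒞.hχ₁ (𝒞.ρ₁ + 3) 𝒞.hρT 𝒞.hχ₁_zero hSχ
    (fun x hx => 𝒞.χ₁_eq_one_of_χ_ne_zero hx) 𝒞.S₁fun (𝒞.contDiff_S₁fun hJs hu₀s)
    (fun x hx => 𝒞.S₁fun_eq_half_S hx) (toOrderZero hr1 h) hker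
  exact ContDiffHolderFunction.ext fun x => by
    simpa using congrArg (fun f : ContDiffHolderFunction ℂ F2 0 r => f x) h0

/-! ### The implicit function -/

/-- **The implicit function at order `k`.** There are `ε, δ > 0` and `γ : ℂ → C^{k,r}_b`, `C^∞` on
`ball 0 ε`, with `γ 0 = 0`, values in `ball 0 δ`, `𝒢(β, γ β) = 0`, and every zero `(β, g)` of `𝒢`
in `ball 0 ε × ball 0 δ` has `g = γ β`. -/
theorem exists_implicitFunction (hR : 0 < R) (hJ2 : ∀ x v, J x (J x v) = -v)
    (hPQ : IsCoordFrame P Q eP eQ)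
    (hJP : ∀ x : E4, R ≤ ‖x‖ → ∀ v, P (J x v) = Complex.I * P v)
    (hJQ : ∀ x : E4, R ≤ ‖x‖ → ∀ v, Q (J x v) = Complex.I * Q v)
    (hu₀J : IsJHolomorphicFlat J u₀) :
    ∃ ε > (0 : ℝ), ∃ δ > (0 : ℝ), ∃ γ : ℂ → ContDiffHolderFunction ℂ F2 k r,
      ContDiffOn ℝ ∞ γ (ball 0 ε) ∧ γ 0 = 0 ∧ (∀ β ∈ ball (0 : ℂ) ε, γ β ∈ ball 0 δ) ∧
      (∀ β ∈ ball (0 : ℂ) ε, (𝒞.vorticity hr0 hr1 hJs hu₀s k).G hr1.le (β, γ β) = 0) ∧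
      (∀ β ∈ ball (0 : ℂ) ε, ∀ g ∈ ball (0 : ContDiffHolderFunction ℂ F2 k r) δ,
        (𝒞.vorticity hr0 hr1 hJs hu₀s k).G hr1.le (β, g) = 0 → g = γ β) := by
  -- Fredholm: `L = 1 + (L - 1)` is an equivalence
  have hK := 𝒞.isCompactOperator_L_sub_one hr0 hr1 hJs hu₀s (k := k)
  have hinj : ∀ x, x + ((𝒞.vorticity hr0 hr1 hJs hu₀s k).L hr1.le - 1) x = 0 → x = 0 := fun x hx =>
    𝒞.L_injective hr0 hr1 hJs hu₀s hR hJ2 hPQ hJP hJQ hu₀J x (by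
      rw [sub_apply] at hx
      simpa using hx)
  obtain ⟨Leq, hLeq⟩ := helper_fredholmOneAdd ((𝒞.vorticity hr0 hr1 hJs hu₀s k).L hr1.le - 1) hK hinj
  have hLeq' : (Leq : ContDiffHolderFunction ℂ F2 k r →L[ℝ] _) = (𝒞.vorticity hr0 hr1 hJs hu₀s k).L hr1.le := by
    refine ContinuousLinearMap.ext fun x => ?_
    rw [ContinuousLinearEquiv.coe_coe, hLeq, sub_apply, one_apply_eq_self]
    abel
  -- the smoothness package of the vorticity map
  obtain ⟨hG, hG0, hGd⟩ := helper_vorticityMapSmooth hr1.le (𝒞.vorticity hr0 hr1 hJs hu₀s k)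
  -- the partial derivative in `g` at the origin as the full derivative composed with `inr`
  have hcomp : (fderiv ℝ ((𝒞.vorticity hr0 hr1 hJs hu₀s k).G hr1.le) (0, 0)).comp (ContinuousLinearMap.inr ℝ ℂ _) =
      (Leq : ContDiffHolderFunction ℂ F2 k r →L[ℝ] _) := by
    rw [hLeq']
    have h1 : HasFDerivAt (fun g : ContDiffHolderFunction ℂ F2 k r => (𝒞.vorticity hr0 hr1 hJs hu₀s k).G hr1.le ((0 : ℂ), g))
        ((fderiv ℝ ((𝒞.vorticity hr0 hr1 hJs hu₀s k).G hr1.le) (0, 0)).comp (ContinuousLinearMap.inr ℝ ℂ _)) 0 := by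
      have hd : HasFDerivAt ((𝒞.vorticity hr0 hr1 hJs hu₀s k).G hr1.le) (fderiv ℝ ((𝒞.vorticity hr0 hr1 hJs hu₀s k).G hr1.le) (0, 0)) ((0 : ℂ), (0 : _)) :=
        (hG.differentiable (by simp) _).hasFDerivAt
      exact hd.comp 0 ((hasFDerivAt_const (0 : ℂ) _).prodMk (hasFDerivAt_id _) |>.congr_fderiv
        (by ext g <;> simp))
    exact h1.unique hGd
  obtain ⟨ε, hε, δ, hδ, γ, hγs, hγ0, hγball, hγzero, hγuniq⟩ :=
    exists_smooth_implicitFunction ((𝒞.vorticity hr0 hr1 hJs hu₀s k).G hr1.le) hG 0 0 hG0 Leq hcomp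
  exact ⟨ε, hε, δ, hδ, γ, hγs, hγ0, hγball, hγzero, hγuniq⟩


end ChartData

end CoreA

/-- **Registered helper `helper_chartImplicitFunction`**: at every Hölder order `k`, the vorticity
map of a chart at a member has a smooth implicit function near the origin (Fredholm alternative for
`L = 1 + compact`, injectivity by the kernel theorem, and the smooth implicit function theorem). -/
theorem helper_chartImplicitFunction (J : EuclideanSpace ℝ (Fin 4) → EuclideanSpace ℝ (Fin 4) →L[ℝ]
      EuclideanSpace ℝ (Fin 4)) (R : ℝ) (P Q : EuclideanSpace ℝ (Fin 4) →L[ℝ] ℂ)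
    (eP eQ : ℂ →L[ℝ] EuclideanSpace ℝ (Fin 4))
    (hR : 0 < R) (hJs : ContDiff ℝ ∞ J) (hJ2 : ∀ x v, J x (J x v) = -v)
    (hPQ : IsCoordFrame P Q eP eQ)
    (hJP : ∀ x : EuclideanSpace ℝ (Fin 4), R ≤ ‖x‖ → ∀ v, P (J x v) = Complex.I * P v)
    (hJQ : ∀ x : EuclideanSpace ℝ (Fin 4), R ≤ ‖x‖ → ∀ v, Q (J x v) = Complex.I * Q v)
    {r : ℝ≥0} (hr0 : 0 < r) (hr1 : r < 1)
    (b₀ : ℂ) (u₀ : ℂ → EuclideanSpace ℝ (Fin 4)) (hu₀ : IsPencilMember J R P Q b₀ u₀)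
    (𝒞 : CoreA.ChartData J R P Q eP eQ b₀ u₀) (k : ℕ) :
    ∃ ε > (0 : ℝ), ∃ δ > (0 : ℝ), ∃ γ : ℂ → ContDiffHolderFunction ℂ (ℂ × ℂ) k r,
      ContDiffOn ℝ ∞ γ (ball 0 ε) ∧ γ 0 = 0 ∧ (∀ β ∈ ball (0 : ℂ) ε, γ β ∈ ball 0 δ) ∧
      (∀ β ∈ ball (0 : ℂ) ε, (𝒞.vorticity hr0 hr1 hJs hu₀.1 k).G hr1.le (β, γ β) = 0) ∧
      (∀ β ∈ ball (0 : ℂ) ε, ∀ g ∈ ball (0 : ContDiffHolderFunction ℂ (ℂ × ℂ) k r) δ,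
        (𝒞.vorticity hr0 hr1 hJs hu₀.1 k).G hr1.le (β, g) = 0 → g = γ β) :=
  𝒞.exists_implicitFunction hr0 hr1 hJs hu₀.1 hR hJ2 hPQ hJP hJQ hu₀.2.1

end Summit.SmoothPoincare4.SmoothPoincare4.Cruxes.TameOrBrodyR4.Sketch
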